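import Literature.AnabelianGeometry.AbsoluteAnabelian.NFDecompositionCommTerminalProofs
import Literature.AnabelianGeometry.AbsoluteAnabelian.MLFSlimKummerProofs
import Literature.NumberTheory.GaloisRepresentations.DecompositionGroupRelSlim
import Literature.NumberTheory.NumberFields.RescaledCompletion
import HarnessLib

/-!
# [AbsAnab] Theorem 1.1.1 (ii), first clause: `G_𝔭 ↪ G_F` is relatively slim — proof

Mochizuki, *The absolute anabelian geometry of hyperbolic curves* (2004), §1.1, Theorem 1.1.1 (ii)
(lit key `paper:url-e8f118cc205e`, p. 6): for a number field `F` and a nonarchimedean prime `𝔭` of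
`F̄`, the inclusion of the decomposition group `G_𝔭 ↪ G_F` is *relatively slim*, i.e. the
centraliser in `G_F` of every open subgroup of `G_𝔭` is trivial.

This PROOF-ONLY file discharges the named fact
`Literature.AnabelianGeometry.AbsoluteAnabelian.galoisNF_decomposition_relativelySlim`
(`MLFGaloisGroups.lean`, abc-iut-L4-t4).  OUR proof: with `𝔓 = 𝔪_A ∩ \bar ℤ_F` the prime of
`\bar ℤ_F` cut out by the valuation subring `A` (`exists_ideal_mem_primesAbove_of_ne_top`,
`decompositionGroupNF_eq_decompositionSubgroup`), an open subgroup `U ⊆ D_𝔓` has finite index, so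
its centraliser lies in `D_𝔓` (non-commensurability of distinct decomposition groups,
`DecompositionGroupCommTerminal.lean`), and `D_𝔓 ≅ Gal(\bar F_v / F_v)` (GalRep trunk,
`decompositionSubgroup_adicCompletionPrime_eq_range` + `absGaloisRestrict_adicCompletion_injective`)
is slim by the tree's theorem `galoisMLF_slim_holds` ([AbsAnab] Thm. 1.1.1 (ii), local half,
abc-iut-L4-d2 gen 0, Kummer-theoretic proof) applied to the finite extension `F_v / ℚ_p`
(`LocalField.adicCompletionPadicAlgebra`, degree `e_v f_v`).

HONEST FRAMING: classical, undisputed algebraic number theory; our kernel check of a refereed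
statement; nothing here bears on [IUTchIII] Cor. 3.12.

## References

* S. Mochizuki, *The absolute anabelian geometry of hyperbolic curves* (2004), Thm. 1.1.1 (ii).
  [MochizukiAbsAnab2004]
* J. Neukirch, A. Schmidt, K. Wingberg, *Cohomology of Number Fields* (2nd ed. 2008), Cor. 12.1.3.
  [NeukirchSchmidtWingberg2008]
-/

noncomputable section

open scoped NumberField Pointwise
open Field IsDedekindDomain Literature.NumberTheory.GaloisRepresentations

namespace Literature.AnabelianGeometry.AbsoluteAnabelian

variable {F : Type} [Field F] [NumberField F]

/-- Every finite place `v` of a number field lies over a rational prime `p` (`p ∈ 𝔭_v`: the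
characteristic of the finite residue field `𝓞 F ⧸ 𝔭_v`).  Neukirch, *Algebraic Number Theory*,
Ch. I §8. [cite: NeukirchANT1999, Ch. I §8 Prop. (8.3)] -/
theorem exists_prime_natCast_mem_asIdeal (v : HeightOneSpectrum (𝓞 F)) :
    ∃ p : ℕ, p.Prime ∧ ((p : ℕ) : 𝓞 F) ∈ v.asIdeal := by
  -- adapted from `SGeneralQuadraticFamily.exists_prime_natCast_mem` (same argument)
  haveI : v.asIdeal.IsPrime := v.isPrime
  haveI : Finite (𝓞 F ⧸ v.asIdeal) := Ideal.finiteQuotientOfFreeOfNeBot v.asIdeal v.ne_bot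
  obtain ⟨q, hq⟩ := CharP.exists (𝓞 F ⧸ v.asIdeal)
  have hqprime : q.Prime := (CharP.char_is_prime_or_zero (𝓞 F ⧸ v.asIdeal) q).resolve_right
    (CharP.char_ne_zero_of_finite (𝓞 F ⧸ v.asIdeal) q)
  refine ⟨q, hqprime, ?_⟩
  rw [← Ideal.Quotient.eq_zero_iff_mem, map_natCast]
  exact CharP.cast_eq_zero _ q

/-- **Slimness of `Gal(\bar F_v / F_v)`** for the completion of a number field at a finite place:
every open subgroup of `Γ_{F_v}` has trivial centraliser — the tree's theorem `galoisMLF_slim_holds`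
([AbsAnab] Thm. 1.1.1 (ii), local half) for the finite extension `F_v / ℚ_p`
(`LocalField.adicCompletionPadicAlgebra`, `[F_v : ℚ_p] = e_v f_v`).
[cite: MochizukiAbsAnab2004, Thm 1.1.1 (ii) p.6] -/
theorem centralizer_eq_bot_of_isOpen_absoluteGaloisGroup_adicCompletion (v : HeightOneSpectrum (𝓞 F))
    (V : Subgroup (absoluteGaloisGroup (v.adicCompletion F)))
    (hV : IsOpen (V : Set (absoluteGaloisGroup (v.adicCompletion F)))) :
    Subgroup.centralizer (V : Set (absoluteGaloisGroup (v.adicCompletion F))) = ⊥ := by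
  obtain ⟨p, hp, hpv⟩ := exists_prime_natCast_mem_asIdeal v
  haveI : Fact p.Prime := ⟨hp⟩
  letI : Algebra ℚ_[p] (v.adicCompletion F) := LocalField.adicCompletionPadicAlgebra v p hpv
  haveI : FiniteDimensional ℚ_[p] (v.adicCompletion F) := by
    apply Module.finite_of_finrank_pos
    rw [← Literature.NumberTheory.NumberFields.RescaledCompletion.localDeg_eq_finrank F p v hpv]
    exact Literature.NumberTheory.NumberFields.localDeg_pos F v
  exact (galoisMLF_slim_holds p (v.adicCompletion F)).centralizer_eq_bot V hV

/-- **[AbsAnab] Theorem 1.1.1 (ii), first clause (discharge of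
`galoisNF_decomposition_relativelySlim`).**  For a number field `F` and a nonarchimedean prime `𝔭` of
`F̄` (a valuation subring `A ≠ ⊤` of `F̄`), the inclusion `G_𝔭 ↪ G_F` is relatively slim: the
centraliser in `G_F` of (the image of) every open subgroup of `G_𝔭` is trivial.  Mochizuki (2004),
Thm. 1.1.1 (ii) p. 6; OUR proof: `G_𝔭 = D_𝔓` for `𝔓 = 𝔪_A ∩ \bar ℤ_F` above a finite place `v`, and
`centralizer_image_decompositionSubgroup_eq_bot` (non-commensurability of distinct decomposition
groups + slimness of `Gal(\bar F_v/F_v)`). [cite: MochizukiAbsAnab2004, Thm 1.1.1 (ii) p.6] -/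
theorem galoisNF_decomposition_relativelySlim_holds : galoisNF_decomposition_relativelySlim := by
  intro F _ _ A hA U hU
  obtain ⟨v, 𝔓, h𝔓v, h𝔓⟩ := exists_ideal_mem_primesAbove_of_ne_top A hA
  have hD := decompositionGroupNF_eq_decompositionSubgroup A 𝔓 h𝔓
  -- transport along the equality of subgroups `G_𝔭 = D_𝔓` (the type of `U` depends on it)
  have key : ∀ (D : Subgroup (absoluteGaloisGroup F))
      (hD : D = 𝔓.decompositionSubgroup (absoluteGaloisGroup F)) (U : Subgroup D)
      (hU : IsOpen (U : Set D)), Subgroup.centralizer (D.subtype '' (U : Set D)) = ⊥ := by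
    intro D hD U hU
    subst hD
    exact centralizer_image_decompositionSubgroup_eq_bot F v
      (centralizer_eq_bot_of_isOpen_absoluteGaloisGroup_adicCompletion v) h𝔓v U hU
  exact key _ hD U hU

/-- **`G_𝔭` is slim** (as a topological group, subspace topology from `G_F`): every open subgroup of
the decomposition group `G_𝔭 ⊆ G_F` of a nonarchimedean prime of `F̄` has trivial centraliser in
`G_𝔭` — immediate from relative slimness (`galoisNF_decomposition_relativelySlim_holds`); this is the
input `hslim` of abc-iut-L4-t11's printed deduction
`galoisNF_decomposition_relativelySlim_of_commensurablyTerminal_of_slim` and the form "`G_v` is slim"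
in which [IUTchI] cites Thm. 1.1.1 (ii). [cite: MochizukiAbsAnab2004, Thm 1.1.1 (ii) p.6] -/
theorem isSlimGroup_decompositionGroupNF (A : ValuationSubring (AlgebraicClosure F)) (hA : A ≠ ⊤) :
    Literature.AlgebraicGeometry.Frobenioids.IsSlimGroup (decompositionGroupNF F A) := by
  refine ⟨fun H hH => ?_⟩
  have key := galoisNF_decomposition_relativelySlim_holds F A hA H hH
  refine (Subgroup.eq_bot_iff_forall _).mpr fun x hx => ?_
  have hx' : (x : absoluteGaloisGroup F) ∈
      Subgroup.centralizer ((decompositionGroupNF F A).subtype '' (H : Set (decompositionGroupNF F A))) := by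
    rw [Subgroup.mem_centralizer_iff]
    rintro _ ⟨h, hh, rfl⟩
    have := (Subgroup.mem_centralizer_iff.mp hx) h hh
    simpa using congrArg ((↑) : decompositionGroupNF F A → absoluteGaloisGroup F) this
  rw [key, Subgroup.mem_bot] at hx'
  exact Subtype.ext hx'

end Literature.AnabelianGeometry.AbsoluteAnabelian
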